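import Summits.NavierStokesRegularity.NavierStokesRegularity.Theorems.StrainDoorsDecayTools
import Summits.NavierStokesRegularity.NavierStokesRegularity.Theorems.ArgmaxDoorsDepletionBounds
import Summits.NavierStokesRegularity.NavierStokesRegularity.Theorems.ArgmaxDoorsFrame
import Literature.Analysis.FluidPDE.ConstantinFeffermanEnstrophySlab
import HarnessLib

/-!
# StrainDoorsDecay — door family S37 «StrainDoors» (nsreg-p1 ROUND-35), plate D_S «GradientUniformDecay»

S-door lane (ns-sfl-p1 g5, first-announce 2026-08-28T18:46:54Z; LEAD ns-s30-p1 g3; texts of record nsreg-p1 g31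
`r35/Sketch37.lean` sha16 265cb074f1d98fd0, `GradientUniformDecay` l.263; `--supports stmt-NavierStokesRegularity-0056
--as helper`). In the frame, on every closed slab `[0,T''] ⊂ [0,T)`, `‖∇u(t,x)‖ → 0` as `|x| → ∞` UNIFORMLY in
`t ∈ [0,T'']` — the compactness input of the first-touch device of doors S37-H/Π.

The route is PRESSURE-FREE (no `∂ₜ∇u`, hence no `∇²p`): for each `t`, `u(t) = K ∗ ω(t)` (Biot–Savart,
`biotSavart_curl_eq_self_of_lintegral_sq_lt_top`: `u(t) ∈ C^∞ ∩ L²`, `div u(t) = 0`, `ω(t) ∈ L²`). Split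
`ω(t) = χ_R(· − x)ω(t) + (1 − χ_R)ω(t)`:
* FAR: `‖∫ ∇K(x−y)(1−χ)ω‖ ≤ 8A' ∫_{|x−y| ≥ R} |ω||x−y|⁻³ ≤ 8A'(4π/(3R³))^{1/2}‖ω(t)‖₂`
  (`hasFDerivAt_biotSavart_far`, `integral_norm_mul_farCube_le`) — small for `R` LARGE, no decay needed;
* NEAR: `‖∇(K ∗ χω)(x)‖ ≤ c(C_{1/2}(χω)(2R)^{1/2} + sup|χω|)` (`exists_norm_fderiv_biotSavart_le`, `γ = ½`), where the
  `½`-Hölder constant is obtained by INTERPOLATION `C_{1/2} ≤ (Lip · 2 sup)^{1/2}` (`holderWith_half_of_lipschitzWith`),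
  `Lip(χω) ≤ sup‖∇ω‖ + (B/R)·m`, `sup|χω| ≤ m`, `m = sup_{|y−x| ≤ 3R} |ω(t,y)|` — small for `|x|` LARGE by the
  LEAD's `ArgmaxDoorsFrame.vorticity_uniform_decay` (uniform in `t`), with `sup_t sup‖∇ω‖` and `sup_t ‖ω(t)‖₂` finite
  on the closed slab (Sobolev class).
`gradientUniformDecay` is the text of the plate δ-unfolded (`gradientUniformDecay_holds : GradientUniformDecay` by
`exact` once P0-37 lands).

WHAT THIS IS NOT: a frame lemma for regularity CRITERIA (doors S37-H/Π); item 0056 `NoTypeII` and NS regularity are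
NOT proved; nothing here is a route or a summit statement.
-/

-- the summit's problem namespace repeats the summit name (tree layout)
set_option linter.dupNamespace false

noncomputable section

open MeasureTheory Set Function Filter Topology Metric InnerProductSpace Real
open scoped NNReal ENNReal RealInnerProductSpace ContDiff
open Literature.Analysis Literature.Analysis.FluidPDE

namespace Summit.NavierStokesRegularity.NavierStokesRegularity.Theorems.ArgmaxDoors

/-! ### The static split of `∇v(x₀)` into near and far Biot–Savart parts -/

/-- **Near/far bound for the velocity gradient at one point.** `v ∈ C²` with `v = K ∗ curl v` and
`curl v ∈ L²`; `f = χ_R(· − x₀)·curl v` is `½`-Hölder with constant `Cf` and bounded by `M`; `c` is the constant of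
`exists_norm_fderiv_biotSavart_le` (`γ = ½`) and `A'` the `C¹` singular-kernel constant of `∇K`. Then
`‖∇v(x₀)‖ ≤ c(Cf(2R)^{1/2} + M) + 8A'(4π/(3R³))^{1/2}‖curl v‖₂`. -/
theorem norm_fderiv_le_near_add_far {A' : ℝ} (hK : IsC1SingularKernel biotSavartCLM A') {c : ℝ}
    (hc : ∀ (g : EuclideanSpace ℝ (Fin 3) → EuclideanSpace ℝ (Fin 3)) (C : ℝ≥0) (x₀ : EuclideanSpace ℝ (Fin 3))
      (R M : ℝ), 0 < R → HolderWith C (1 / 2) g → tsupport g ⊆ closedBall x₀ R → (∀ y, ‖g y‖ ≤ M) →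
      ∀ x, ‖fderiv ℝ (biotSavart g) x‖ ≤ c * (C * R ^ (((1 / 2 : ℝ≥0)) : ℝ) + M))
    {v : EuclideanSpace ℝ (Fin 3) → EuclideanSpace ℝ (Fin 3)} (hv : ContDiff ℝ 2 v)
    (hrep : biotSavart (curl v) = v) (hw2 : Integrable fun y => ‖curl v y‖ ^ 2)
    (x₀ : EuclideanSpace ℝ (Fin 3)) {R : ℝ} (hR : 0 < R) {Cf : ℝ≥0}
    (hHolder : HolderWith Cf (1 / 2) (fun y => suppCutoff x₀ R y • curl v y)) {M : ℝ}
    (hM : ∀ y, ‖suppCutoff x₀ R y • curl v y‖ ≤ M)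
    (hts : tsupport (fun y => suppCutoff x₀ R y • curl v y) ⊆ closedBall x₀ (2 * R)) :
    ‖fderiv ℝ v x₀‖ ≤ c * (Cf * (2 * R) ^ (((1 / 2 : ℝ≥0)) : ℝ) + M) +
      8 * A' * ((4 * π / (3 * R ^ 3)) ^ (1 / (2 : ℝ)) * (∫ y, ‖curl v y‖ ^ 2) ^ (1 / (2 : ℝ))) := by
  have hA' : 0 ≤ A' := hK.nonneg
  have hw1 : ContDiff ℝ 1 (curl v) := contDiff_curl (n := 1) (by exact hv)
  have hwc : Continuous (curl v) := hw1.continuous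
  have hχ : ContDiff ℝ 1 (suppCutoff x₀ R) := contDiff_suppCutoff x₀ R
  have hχc : HasCompactSupport (suppCutoff x₀ R) := hasCompactSupport_suppCutoff x₀ hR
  -- near part `f = χ ω` and far part `h = (1 − χ) ω` as genuine variables
  obtain ⟨f, hf_def⟩ : ∃ f : EuclideanSpace ℝ (Fin 3) → EuclideanSpace ℝ (Fin 3),
      f = fun y => suppCutoff x₀ R y • curl v y := ⟨_, rfl⟩
  obtain ⟨h, hh_def⟩ : ∃ h : EuclideanSpace ℝ (Fin 3) → EuclideanSpace ℝ (Fin 3),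
      h = fun y => (1 - suppCutoff x₀ R y) • curl v y := ⟨_, rfl⟩
  rw [← hf_def] at hHolder hts
  have hM' : ∀ y, ‖f y‖ ≤ M := fun y => by rw [hf_def]; exact hM y
  have hfh : ∀ y, f y + h y = curl v y := by
    intro y
    rw [hf_def, hh_def]
    simp only
    rw [← add_smul, add_sub_cancel, one_smul]
  have hf1 : ContDiff ℝ 1 f := by rw [hf_def]; exact hχ.smul hw1
  have hfc : HasCompactSupport f := by rw [hf_def]; exact hχc.smul_right
  have hfcont : Continuous f := hf1.continuous
  -- the near bound
  have hnear : ‖fderiv ℝ (biotSavart f) x₀‖ ≤ c * (Cf * (2 * R) ^ (((1 / 2 : ℝ≥0)) : ℝ) + M) :=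
    hc f Cf x₀ (2 * R) M (by positivity) hHolder hts hM' x₀
  -- the far part
  have hhc : Continuous h := by
    rw [hh_def]; exact (continuous_const.sub hχ.continuous).smul hwc
  have hhle : ∀ y, ‖h y‖ ≤ ‖curl v y‖ := by
    intro y
    rw [hh_def]
    simp only
    rw [norm_smul, Real.norm_eq_abs]
    have h01 : |1 - suppCutoff x₀ R y| ≤ 1 := by
      rw [abs_le]
      constructor <;> linarith [suppCutoff_nonneg x₀ R y, suppCutoff_le_one x₀ R y]
    exact mul_le_of_le_one_left (norm_nonneg _) h01
  have hh2 : Integrable fun y => ‖h y‖ ^ 2 := by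
    refine hw2.mono' ((hhc.norm.pow 2).aestronglyMeasurable) (Eventually.of_forall fun y => ?_)
    rw [Real.norm_of_nonneg (sq_nonneg _)]
    exact pow_le_pow_left₀ (norm_nonneg _) (hhle y) 2
  have hvan : ∀ y, ‖y - x₀‖ < R → h y = 0 := by
    intro y hy
    rw [hh_def]
    simp only
    rw [suppCutoff_eq_one hR hy.le, sub_self, zero_smul]
  obtain ⟨hint, hderiv, hbound⟩ := hasFDerivAt_biotSavart_far hK hhc hh2 hR hvan
  -- linearity of the Biot–Savart integral near `x₀`
  have hEq : v =ᶠ[𝓝 x₀] fun x => biotSavart f x + biotSavart h x := by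
    filter_upwards [Metric.ball_mem_nhds x₀ (half_pos hR)] with x hx
    rw [mem_ball, dist_eq_norm] at hx
    have hfi : Integrable fun y => biotSavartKernel (x - y) (f y) :=
      integrable_biotSavartKernel_sub_apply_of_hasCompactSupport hfcont hfc x
    have hhi : Integrable fun y => biotSavartKernel (x - y) (h y) := hint x hx
    have hsum : biotSavart f x + biotSavart h x =
        ∫ y, (biotSavartKernel (x - y) (f y) + biotSavartKernel (x - y) (h y)) := by
      unfold biotSavart
      rw [integral_add hfi hhi]
    rw [hsum, ← congrFun hrep x]
    unfold biotSavart
    refine integral_congr_ae (Eventually.of_forall fun y => ?_)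
    show biotSavartKernel (x - y) (curl v y) = biotSavartKernel (x - y) (f y) + biotSavartKernel (x - y) (h y)
    rw [← biotSavartCLM_apply, ← biotSavartCLM_apply, ← biotSavartCLM_apply, ← map_add, hfh]
  -- the derivative of `v` at `x₀`
  have hHolder' : HolderWith Cf (1 / 2) f := hHolder
  have hDf : HasFDerivAt (biotSavart f) (fderiv ℝ (biotSavart f) x₀) x₀ :=
    (((contDiff_biotSavart (by norm_num) hHolder' hfc).differentiable one_ne_zero) x₀).hasFDerivAt
  have hDv : HasFDerivAt v
      (fderiv ℝ (biotSavart f) x₀ + ∫ y, (fderiv ℝ biotSavartCLM (x₀ - y)).flip (h y)) x₀ :=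
    (hDf.add hderiv).congr_of_eventuallyEq hEq
  rw [hDv.fderiv]
  refine (norm_add_le _ _).trans (add_le_add hnear (hbound.trans ?_))
  -- the far integral against the `L²` tail
  have h4 : ∫ y, ‖h y‖ * (ball (0 : EuclideanSpace ℝ (Fin 3)) R)ᶜ.indicator (fun z => (‖z‖ ^ 3)⁻¹) (x₀ - y) ≤
      ∫ y, ‖curl v y‖ * (ball (0 : EuclideanSpace ℝ (Fin 3)) R)ᶜ.indicator (fun z => (‖z‖ ^ 3)⁻¹) (x₀ - y) := by
    refine integral_mono_of_nonneg (Eventually.of_forall fun y => ?_)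
      (integrable_norm_mul_farCube hwc hw2 x₀ hR) (Eventually.of_forall fun y => ?_)
    · exact mul_nonneg (norm_nonneg _) (farKernel_nonneg 3 R _)
    · exact mul_le_mul_of_nonneg_right (hhle y) (farKernel_nonneg 3 R _)
  have h5 := integral_norm_mul_farCube_le hwc hw2 x₀ hR
  exact mul_le_mul_of_nonneg_left (h4.trans h5) (by positivity)
/-! ### Plate D_S «GradientUniformDecay» -/

/-- **One slice, all constants explicit**: for `v ∈ C^∞ ∩ L²` divergence free with `∫⁻‖Dv‖ₑ² ≤ C₁`,
`‖∇(curl v)‖ ≤ L`, and `|curl v| ≤ m` on `B̄(x, 3R)`: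
`‖∇v(x)‖ ≤ c(√(2(L + (B/R)m)m)·√(2R) + m) + 8A'·√(4π/(3R³))·√((‖curlCLM‖²C₁).toReal)`. -/
theorem norm_fderiv_slice_le {A' : ℝ} (hK : IsC1SingularKernel biotSavartCLM A') {c : ℝ}
    (hc : ∀ (g : EuclideanSpace ℝ (Fin 3) → EuclideanSpace ℝ (Fin 3)) (C : ℝ≥0) (x₀ : EuclideanSpace ℝ (Fin 3))
      (R M : ℝ), 0 < R → HolderWith C (1 / 2) g → tsupport g ⊆ closedBall x₀ R → (∀ y, ‖g y‖ ≤ M) →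
      ∀ x, ‖fderiv ℝ (biotSavart g) x‖ ≤ c * (C * R ^ (((1 / 2 : ℝ≥0)) : ℝ) + M))
    {B : ℝ} (hB0 : 0 ≤ B)
    (hBχ : ∀ ε : ℝ, 0 < ε → ∀ z : EuclideanSpace ℝ (Fin 3), ‖fderiv ℝ (radialCutoff ε (2 * ε)) z‖ ≤ B * ε⁻¹)
    {v : EuclideanSpace ℝ (Fin 3) → EuclideanSpace ℝ (Fin 3)} (hv : ContDiff ℝ 2 v)
    (hdiv : VectorCalculus.IsDivFree v) (hv2' : ∫⁻ y, ‖v y‖ₑ ^ 2 < ⊤) {C₁ : ℝ≥0}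
    (hC₁ : ∫⁻ y, ‖iteratedFDeriv ℝ 1 v y‖ₑ ^ 2 ≤ C₁) {L : ℝ} (hL0 : 0 ≤ L) (hL : ∀ y, ‖fderiv ℝ (curl v) y‖ ≤ L)
    (x : EuclideanSpace ℝ (Fin 3)) {R : ℝ} (hR : 0 < R) {m : ℝ} (hm0 : 0 ≤ m)
    (hmloc : ∀ y, ‖y - x‖ ≤ 3 * R → ‖curl v y‖ ≤ m) :
    ‖fderiv ℝ v x‖ ≤ c * (Real.sqrt (2 * (L + B * R⁻¹ * m) * m) * Real.sqrt (2 * R) + m) +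
      8 * A' * (Real.sqrt (4 * π / (3 * R ^ 3)) *
        Real.sqrt ((ENNReal.ofReal (‖curlCLM‖ ^ 2) * C₁).toReal)) := by
  have hA' : 0 ≤ A' := hK.nonneg
  obtain ⟨hw2, hWle⟩ := integral_norm_curl_sq_le_of_lintegral hv hC₁
  have hw2' : ∫⁻ y, ‖curl v y‖ₑ ^ 2 < ⊤ :=
    lt_of_le_of_lt ((lintegral_curl_sq_le v).trans (mul_le_mul' le_rfl hC₁))
      (ENNReal.mul_lt_top ENNReal.ofReal_lt_top ENNReal.coe_lt_top)
  have hrep : biotSavart (curl v) = v := biotSavart_curl_eq_self_of_lintegral_sq_lt_top hv hdiv hv2' hw2'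
  have hw1 : ContDiff ℝ 1 (curl v) := contDiff_curl (n := 1) (by exact hv)
  -- the near-field cutoff and its Hölder constant
  obtain ⟨hLip, hMf, hts⟩ := cutoff_smul_bounds hw1 hL0 hm0 hB0 hL hBχ x hR hmloc
  have hMf' : ∀ y, ‖suppCutoff x R y • curl v y‖ ≤ ((m.toNNReal : ℝ≥0) : ℝ) := fun y => by
    rw [Real.coe_toNNReal _ hm0]; exact hMf y
  have hHolder := holderWith_half_of_lipschitzWith hLip hMf'
  have hmain := norm_fderiv_le_near_add_far hK hc hv hrep hw2 x hR hHolder hMf hts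
  refine hmain.trans ?_
  rw [coe_interpolated_const]
  have hhalf : (((1 / 2 : ℝ≥0)) : ℝ) = 1 / 2 := by norm_num
  rw [hhalf, ← Real.sqrt_eq_rpow, ← Real.sqrt_eq_rpow, ← Real.sqrt_eq_rpow, Real.coe_toNNReal _ (by positivity),
    Real.coe_toNNReal _ hm0]
  have h1 : Real.sqrt (∫ y, ‖curl v y‖ ^ 2) ≤ Real.sqrt ((ENNReal.ofReal (‖curlCLM‖ ^ 2) * C₁).toReal) :=
    Real.sqrt_le_sqrt hWle
  have h2 : 8 * A' * (Real.sqrt (4 * π / (3 * R ^ 3)) * Real.sqrt (∫ y, ‖curl v y‖ ^ 2)) ≤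
      8 * A' * (Real.sqrt (4 * π / (3 * R ^ 3)) * Real.sqrt ((ENNReal.ofReal (‖curlCLM‖ ^ 2) * C₁).toReal)) :=
    mul_le_mul_of_nonneg_left (mul_le_mul_of_nonneg_left h1 (Real.sqrt_nonneg _)) (by positivity)
  linarith

/-- **Plate D_S «GradientUniformDecay»** (nsreg-p1 ROUND-35, `Sketch37.lean` l.263), PROVED — the text δ-unfolded:
in the frame, on every closed slab `[0,T''] ⊂ [0,T)`, `‖∇u(t,x)‖ → 0` as `|x| → ∞` uniformly in `t ∈ [0,T'']`.
Pressure-free route: Biot–Savart slice by slice, far part by the `L²` tail of the kernel gradient, near part by the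
`½`-Hölder sup bound with the Hölder constant interpolated from `sup‖∇ω‖` and the uniformly small local sup of `ω`
(`vorticity_uniform_decay`). -/
theorem gradientUniformDecay : ∀ (ν T : ℝ), 0 < ν → 0 < T →
    ∀ (u : ℝ → (EuclideanSpace ℝ (Fin 3)) → (EuclideanSpace ℝ (Fin 3)))
      (p : ℝ → (EuclideanSpace ℝ (Fin 3)) → ℝ),
      IsClassicalNSSolutionOn (Ico 0 T) ν 0 u p →
      (∀ T'' < T, HasBoundedSobolevNormsOn (Icc 0 T'') u) →
      ∀ T'' < T, ∀ η : ℝ, 0 < η → ∃ R : ℝ, ∀ t ∈ Icc 0 T'', ∀ x : EuclideanSpace ℝ (Fin 3),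
        R ≤ ‖x‖ → ‖fderiv ℝ (u t) x‖ ≤ η := by
  intro ν T hν hT u p hsol hreg T'' hT'' η hη
  -- enlarge the slab to `[0, T₁]`, `T₁ = max T'' (T/2) ∈ (0, T)`
  obtain ⟨T₁, hT₁⟩ : ∃ T₁ : ℝ, T₁ = max T'' (T / 2) := ⟨_, rfl⟩
  have hT₁T : T₁ < T := by rw [hT₁]; exact max_lt hT'' (by linarith)
  have hT₁0 : 0 < T₁ := by rw [hT₁]; exact lt_of_lt_of_le (by linarith) (le_max_right _ _)
  have hsub : Icc 0 T'' ⊆ Icc 0 T₁ := Icc_subset_Icc le_rfl (by rw [hT₁]; exact le_max_left _ _)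
  have hS : IsClassicalNSSolutionOn (Icc 0 T₁) ν 0 u p :=
    hsol.mono (Icc_subset_Ico_right hT₁T) (uniqueDiffOn_Icc hT₁0)
  have hB : HasBoundedSobolevNormsOn (Icc 0 T₁) u := hreg T₁ hT₁T
  -- universal constants
  obtain ⟨A', hK⟩ := exists_isC1SingularKernel_biotSavartCLM
  have hA' : 0 ≤ A' := hK.nonneg
  obtain ⟨c, hc0, hc⟩ := exists_norm_fderiv_biotSavart_le (γ := 1 / 2) (by norm_num)
  obtain ⟨B, hB0, hBχ⟩ := exists_norm_fderiv_radialCutoff_le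
  -- slab constants: enstrophy `Wsq`, vorticity-gradient sup `L`
  obtain ⟨C₁, hC₁⟩ := hB 1
  obtain ⟨Wsq, hWsq⟩ : ∃ W : ℝ, W = (ENNReal.ofReal (‖curlCLM‖ ^ 2) * C₁).toReal := ⟨_, rfl⟩
  have hWsq0 : 0 ≤ Wsq := by rw [hWsq]; exact ENNReal.toReal_nonneg
  obtain ⟨C₂, hC₂⟩ := exists_forall_norm_iteratedFDeriv_le_of_hasBoundedSobolevNormsOn
    (fun t ht => hS.contDiff_velocity ht) hB 2
  obtain ⟨L, hL⟩ : ∃ L : ℝ, L = ‖curlCLM‖ * max C₂ 0 := ⟨_, rfl⟩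
  have hL0 : 0 ≤ L := by rw [hL]; positivity
  have hLb : ∀ t ∈ Icc 0 T₁, ∀ y, ‖fderiv ℝ (curl (u t)) y‖ ≤ L := by
    intro t ht y
    have hv : ContDiff ℝ ∞ (u t) := hS.contDiff_velocity ht
    have h1 : ‖fderiv ℝ (curl (u t)) y‖ = ‖iteratedFDeriv ℝ 1 (curl (u t)) y‖ := by
      rw [← norm_iteratedFDeriv_fderiv, norm_iteratedFDeriv_zero]
    rw [h1, hL]
    refine (norm_iteratedFDeriv_curl_le_opNorm_mul hv 1 (by exact_mod_cast le_top) y).trans ?_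
    exact mul_le_mul_of_nonneg_left ((hC₂ t ht y).trans (le_max_left _ _)) (by positivity)
  -- the far radius `R`
  obtain ⟨F, hF⟩ : ∃ F : ℝ, F = 8 * A' * Real.sqrt Wsq := ⟨_, rfl⟩
  have hF0 : 0 ≤ F := by rw [hF]; positivity
  obtain ⟨δ, hδ⟩ : ∃ δ : ℝ, δ = η / (2 * (F + 1)) := ⟨_, rfl⟩
  have hδ0 : 0 < δ := by rw [hδ]; positivity
  obtain ⟨R, hRdef⟩ : ∃ R : ℝ, R = max 1 (4 * π / (3 * δ ^ 2)) := ⟨_, rfl⟩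
  have hR1 : 1 ≤ R := by rw [hRdef]; exact le_max_left _ _
  have hR : 0 < R := lt_of_lt_of_le one_pos hR1
  have hfarR : Real.sqrt (4 * π / (3 * R ^ 3)) ≤ δ := by
    have h1 : 4 * π / (3 * δ ^ 2) ≤ R := by rw [hRdef]; exact le_max_right _ _
    have hRR : (1 : ℝ) ≤ R ^ 2 := by nlinarith only [hR1]
    have h2 : R ≤ R ^ 3 := by nlinarith only [mul_nonneg hR.le (sub_nonneg.2 hRR)]
    have h3 : 4 * π / (3 * R ^ 3) ≤ δ ^ 2 := by
      rw [div_le_iff₀ (by positivity)]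
      rw [div_le_iff₀ (by positivity)] at h1
      nlinarith only [hδ0, Real.pi_pos, h1, h2]
    calc Real.sqrt (4 * π / (3 * R ^ 3)) ≤ Real.sqrt (δ ^ 2) := Real.sqrt_le_sqrt h3
      _ = δ := Real.sqrt_sq hδ0.le
  -- the near level `m`
  obtain ⟨G, hG⟩ : ∃ G : ℝ, G = c * (2 * Real.sqrt ((L + B) * R) + 1) := ⟨_, rfl⟩
  have hG0 : 0 ≤ G := by rw [hG]; positivity
  obtain ⟨s, hs⟩ : ∃ s : ℝ, s = min 1 (η / (2 * (G + 1))) := ⟨_, rfl⟩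
  have hs0 : 0 < s := by rw [hs]; exact lt_min one_pos (by positivity)
  have hs1 : s ≤ 1 := by rw [hs]; exact min_le_left _ _
  have hsη : s ≤ η / (2 * (G + 1)) := by rw [hs]; exact min_le_right _ _
  obtain ⟨m, hm⟩ : ∃ m : ℝ, m = s ^ 2 := ⟨_, rfl⟩
  have hm0 : 0 < m := by rw [hm]; positivity
  have hm1 : m ≤ 1 := by rw [hm]; nlinarith only [hs0, hs1]
  have hms : m ≤ s := by rw [hm]; nlinarith only [hs0, hs1]
  have hsqm : Real.sqrt m = s := by rw [hm, Real.sqrt_sq hs0.le]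
  -- uniform decay of the vorticity at level `m`
  obtain ⟨ρ₀, hρ₀⟩ := vorticity_uniform_decay hν hT₁0 hS hB m hm0
  refine ⟨ρ₀ + 3 * R, fun t ht' x hx => ?_⟩
  have ht : t ∈ Icc 0 T₁ := hsub ht'
  -- slice data
  have hv : ContDiff ℝ ∞ (u t) := hS.contDiff_velocity ht
  have hv2 : ContDiff ℝ 2 (u t) := hv.of_le (by norm_cast)
  have hdiv : VectorCalculus.IsDivFree (u t) := hS.divFree t ht
  obtain ⟨C₀, hC₀⟩ := hB 0
  have hv2' : ∫⁻ y, ‖u t y‖ₑ ^ 2 < ⊤ := by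
    have h' : ∫⁻ y, ‖u t y‖ₑ ^ 2 ≤ C₀ := by
      refine le_of_eq_of_le (lintegral_congr fun y => ?_) (hC₀ t ht)
      rw [← ofReal_norm, ← ofReal_norm, norm_iteratedFDeriv_zero]
    exact lt_of_le_of_lt h' ENNReal.coe_lt_top
  -- the local sup of `ω(t)` near `x` is `≤ m`
  have hmloc : ∀ y, ‖y - x‖ ≤ 3 * R → ‖curl (u t) y‖ ≤ m := by
    intro y hy
    refine hρ₀ t ht y ?_
    have : ‖x‖ ≤ ‖y‖ + ‖y - x‖ := by
      calc ‖x‖ = ‖y - (y - x)‖ := by rw [sub_sub_cancel]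
        _ ≤ ‖y‖ + ‖y - x‖ := norm_sub_le _ _
    linarith only [hx, this, hy]
  have hslice := norm_fderiv_slice_le hK hc hB0 hBχ hv2 hdiv hv2' (hC₁ t ht) hL0 (hLb t ht) x hR hm0.le
    hmloc
  rw [← hWsq] at hslice
  refine hslice.trans ?_
  -- bookkeeping: near ≤ η/2, far ≤ η/2
  have hnear : c * (Real.sqrt (2 * (L + B * R⁻¹ * m) * m) * Real.sqrt (2 * R) + m) ≤ η / 2 := by
    have hRinv : R⁻¹ ≤ 1 := inv_le_one_of_one_le₀ hR1
    have h1 : L + B * R⁻¹ * m ≤ L + B := by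
      have : B * R⁻¹ * m ≤ B * 1 * 1 :=
        mul_le_mul (mul_le_mul_of_nonneg_left hRinv hB0) hm1 hm0.le (by positivity)
      linarith only [this]
    have hsq : (2 * Real.sqrt ((L + B) * R) * s) ^ 2 = 4 * ((L + B) * R) * m := by
      rw [mul_pow, mul_pow, Real.sq_sqrt (by positivity), hm]; ring
    have h9 : (L + B * R⁻¹ * m) * (m * R) ≤ (L + B) * (m * R) :=
      mul_le_mul_of_nonneg_right h1 (by positivity)
    have h10 : 2 * (L + B * R⁻¹ * m) * m * (2 * R) ≤ (2 * Real.sqrt ((L + B) * R) * s) ^ 2 := by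
      rw [hsq]
      calc 2 * (L + B * R⁻¹ * m) * m * (2 * R) = 4 * ((L + B * R⁻¹ * m) * (m * R)) := by ring
        _ ≤ 4 * ((L + B) * (m * R)) := mul_le_mul_of_nonneg_left h9 (by norm_num)
        _ = 4 * ((L + B) * R) * m := by ring
    have h2 : Real.sqrt (2 * (L + B * R⁻¹ * m) * m) * Real.sqrt (2 * R) ≤ 2 * Real.sqrt ((L + B) * R) * s := by
      rw [← Real.sqrt_mul (by positivity)]
      calc Real.sqrt (2 * (L + B * R⁻¹ * m) * m * (2 * R))
          ≤ Real.sqrt ((2 * Real.sqrt ((L + B) * R) * s) ^ 2) := Real.sqrt_le_sqrt h10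
        _ = 2 * Real.sqrt ((L + B) * R) * s := Real.sqrt_sq (by positivity)
    have h3 : c * (Real.sqrt (2 * (L + B * R⁻¹ * m) * m) * Real.sqrt (2 * R) + m) ≤ G * s := by
      rw [hG]
      calc c * (Real.sqrt (2 * (L + B * R⁻¹ * m) * m) * Real.sqrt (2 * R) + m)
          ≤ c * (2 * Real.sqrt ((L + B) * R) * s + s) := mul_le_mul_of_nonneg_left (add_le_add h2 hms) hc0
        _ = c * (2 * Real.sqrt ((L + B) * R) + 1) * s := by ring
    have h4 : G * s ≤ G * (η / (2 * (G + 1))) := mul_le_mul_of_nonneg_left hsη hG0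
    have h5 : G * (η / (2 * (G + 1))) ≤ η / 2 := by
      rw [← mul_div_assoc, div_le_div_iff₀ (by positivity) (by positivity)]
      nlinarith only [hG0, hη]
    linarith only [h3, h4, h5]
  have hfar : 8 * A' * (Real.sqrt (4 * π / (3 * R ^ 3)) * Real.sqrt Wsq) ≤ η / 2 := by
    have h6 : Real.sqrt (4 * π / (3 * R ^ 3)) * Real.sqrt Wsq ≤ δ * Real.sqrt Wsq :=
      mul_le_mul_of_nonneg_right hfarR (Real.sqrt_nonneg _)
    have h7 := mul_le_mul_of_nonneg_left h6 (by positivity : (0 : ℝ) ≤ 8 * A')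
    have h8 : 8 * A' * (δ * Real.sqrt Wsq) = F * δ := by rw [hF]; ring
    have h3 : F * δ ≤ η / 2 := by
      rw [hδ, ← mul_div_assoc, div_le_div_iff₀ (by positivity) (by positivity)]
      nlinarith only [hF0, hη]
    linarith only [h7, h8, h3]
  linarith only [hslice, hnear, hfar]

end Summit.NavierStokesRegularity.NavierStokesRegularity.Theorems.ArgmaxDoors

end
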